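import Literature.RingTheory.FormalGroups.UniversalTypicalLawLinear
import HarnessLib

/-!
# Coefficient bookkeeping for Lazard's bud lemma: the four substitutions of a homogeneous `Γ(X,Y) = Σ γ_s X^s Y^{n-s}`
# ([Lazard 1955] §III (3.4)–(3.6))

Topic `Literature/RingTheory/FormalGroups`; namespace `Literature.RingTheory.FormalGroups`.  THEOREMS ONLY; no definition,
no named fact, no instance, no `sorry`.  For a coefficient family `γ : ℕ → B` and `n`, let
`Γ = Σ_{s ≤ n} γ_s X₀^s X₁^{n-s} ∈ B⟦X₀,X₁⟧`.  Lazard translates the coboundary identity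
`δΓ(x,y,z) = Γ(y,z) - Γ(x+y,z) + Γ(x,y+z) - Γ(x,y) = 0` into relations on the `γ_s` by reading off the coefficient of
`x^i y^j z^l` ((3.5)–(3.6)).  This file computes those coefficients for the four substituted series
(`coeff_homog_subst_01`, `_12`, `_add_2`, `_0_add`), the coefficients of `Γ` itself and of Lazard's `C_n = lazardPoly`
(`coeff_homog`, `coeff_lazardPoly`), and of the swapped `Γ(X₁,X₀)` (`coeff_homog_swap`).

## References
* [Lazard1955] M. Lazard, Bull. SMF 83 (1955), §III, (3.4)–(3.6).
-/

noncomputable section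

namespace Literature.RingTheory.FormalGroups

open MvPowerSeries Finset Finsupp

variable {B : Type*} [CommRing B]

/-! ## §1 Monomial coefficients in two and three variables -/

/-- Exponent vectors in two variables are determined by their two values. [folklore] -/
private theorem fin2_eq_iff {i j a b : ℕ} :
    (single 0 i + single 1 j : Fin 2 →₀ ℕ) = single 0 a + single 1 b ↔ a = i ∧ b = j := by
  constructor
  · intro h
    have h0 := DFunLike.congr_fun h 0
    have h1 := DFunLike.congr_fun h 1
    simp at h0 h1
    exact ⟨h0.symm, h1.symm⟩
  · rintro ⟨rfl, rfl⟩; rfl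

/-- Exponent vectors in three variables are determined by their three values. [folklore] -/
private theorem fin3_eq_iff {i j l a b c : ℕ} :
    (single 0 i + single 1 j + single 2 l : Fin 3 →₀ ℕ) = single 0 a + single 1 b + single 2 c ↔ a = i ∧ b = j ∧ c = l := by
  constructor
  · intro h
    have h0 := DFunLike.congr_fun h 0
    have h1 := DFunLike.congr_fun h 1
    have h2 := DFunLike.congr_fun h 2
    simp at h0 h1 h2
    exact ⟨h0.symm, h1.symm, h2.symm⟩
  · rintro ⟨rfl, rfl, rfl⟩; rfl

/-- Every two-variable exponent vector is `(d 0, d 1)` (the monomials `x^i y^j`). [cite: Lazard1955, §III (3.4)] -/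
theorem fin2_eq_single_add_single (d : Fin 2 →₀ ℕ) : d = single 0 (d 0) + single 1 (d 1) := by
  ext i; fin_cases i <;> simp

/-- Every three-variable exponent vector is `(d 0, d 1, d 2)` (the monomials `x^i y^j z^k`). [cite: Lazard1955, §III (3.6)] -/
theorem fin3_eq_single_add_single (d : Fin 3 →₀ ℕ) : d = single 0 (d 0) + single 1 (d 1) + single 2 (d 2) := by
  ext i; fin_cases i <;> simp

/-- `[X₀^i X₁^j] X₀^a X₁^b = δ_{a,i} δ_{b,j}`. [cite: Lazard1955, §III (3.6)] -/
theorem coeff_X_pow_mul_X_pow (i j a b : ℕ) :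
    coeff (single 0 i + single 1 j) ((X 0) ^ a * (X 1) ^ b : MvPowerSeries (Fin 2) B) = if a = i ∧ b = j then 1 else 0 := by
  classical
  rw [X_pow_eq, X_pow_eq, monomial_mul_monomial, coeff_monomial, mul_one]
  simp only [fin2_eq_iff]

/-- `[Y₀^i Y₁^j Y₂^l] Y₀^a Y₁^b Y₂^c = δ_{a,i} δ_{b,j} δ_{c,l}`. [cite: Lazard1955, §III (3.6)] -/
theorem coeff_X_pow_mul_X_pow_mul_X_pow (i j l a b c : ℕ) :
    coeff (single 0 i + single 1 j + single 2 l) ((X 0) ^ a * (X 1) ^ b * (X 2) ^ c : MvPowerSeries (Fin 3) B) =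
      if a = i ∧ b = j ∧ c = l then 1 else 0 := by
  classical
  rw [X_pow_eq, X_pow_eq, X_pow_eq, monomial_mul_monomial, monomial_mul_monomial, coeff_monomial, mul_one, mul_one]
  simp only [fin3_eq_iff]

/-! ## §2 Substituting into `Γ = Σ γ_s X₀^s X₁^{n-s}` -/

/-- `Γ(a₀,a₁) = Σ γ_s a₀^s a₁^{n-s}`. [cite: Lazard1955, §III (3.4)] -/
theorem subst_homog {τ : Type*} (γ : ℕ → B) (n : ℕ) {a : Fin 2 → MvPowerSeries τ B} (ha : HasSubst a) :
    subst a (∑ s ∈ range (n + 1), γ s • ((X 0) ^ s * (X 1) ^ (n - s)) : MvPowerSeries (Fin 2) B) =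
      ∑ s ∈ range (n + 1), γ s • ((a 0) ^ s * (a 1) ^ (n - s)) := by
  rw [← coe_substAlgHom ha, map_sum]
  refine sum_congr rfl fun s _ => ?_
  rw [map_smul, map_mul, map_pow, map_pow, coe_substAlgHom, subst_X ha, subst_X ha]

/-- `[X₀^i X₁^{n-i}] Γ = γ_i` (`i ≤ n`). [cite: Lazard1955, §III (3.4)] -/
theorem coeff_homog (γ : ℕ → B) {n i : ℕ} (hi : i ≤ n) :
    coeff (single 0 i + single 1 (n - i)) (∑ s ∈ range (n + 1), γ s • ((X 0) ^ s * (X 1) ^ (n - s)) : MvPowerSeries (Fin 2) B) = γ i := by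
  rw [map_sum]
  simp_rw [map_smul, coeff_X_pow_mul_X_pow, smul_eq_mul, mul_ite, mul_one, mul_zero]
  rw [sum_eq_single i (fun s _ hs => if_neg fun h => hs h.1) (fun h => absurd (mem_range.mpr (by omega)) h)]
  rw [if_pos ⟨rfl, rfl⟩]

/-- `Γ` has no coefficients off degree `n`: `[X₀^i X₁^j]Γ = 0` if `i + j ≠ n`. [cite: Lazard1955, §III (3.4)] -/
theorem coeff_homog_of_ne (γ : ℕ → B) {n i j : ℕ} (h : i + j ≠ n) :
    coeff (single 0 i + single 1 j) (∑ s ∈ range (n + 1), γ s • ((X 0) ^ s * (X 1) ^ (n - s)) : MvPowerSeries (Fin 2) B) = 0 := by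
  rw [map_sum]
  refine sum_eq_zero fun s hs => ?_
  rw [mem_range] at hs
  rw [map_smul, coeff_X_pow_mul_X_pow, if_neg, smul_zero]
  omega

/-- `[X₀^i X₁^{n-i}] C_n = b_{n,i}` for `0 < i < n`, and `0` for `i = 0` or `i = n`. [cite: Lazard1955, Lemme 3] -/
theorem coeff_lazardPoly (n i : ℕ) :
    coeff (single 0 i + single 1 (n - i)) (lazardPoly B n) = if 0 < i ∧ i < n then (lazardCoeff n i : B) else 0 := by
  rw [lazardPoly, map_sum]
  simp_rw [map_smul, coeff_X_pow_mul_X_pow, smul_eq_mul, mul_ite, mul_one, mul_zero]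
  by_cases h : 0 < i ∧ i < n
  · rw [if_pos h, sum_eq_single i (fun s _ hs => if_neg fun h' => hs h'.1) (fun h' => absurd (mem_Ioo.mpr h) h'),
      if_pos ⟨rfl, rfl⟩]
  · rw [if_neg h]
    refine sum_eq_zero fun s hs => if_neg fun h' => ?_
    rw [mem_Ioo] at hs
    exact h ⟨h'.1 ▸ hs.1, h'.1 ▸ hs.2⟩

/-- Coefficient of `Y₀^i Y₁^j Y₂^l` (`i+j+l = n`) in `Γ(Y₀,Y₁)`: `γ_i` if `l = 0`, else `0`. [cite: Lazard1955, §III (3.5)–(3.6)] -/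
theorem coeff_homog_subst_01 (γ : ℕ → B) {n i j l : ℕ} (h : i + j + l = n) :
    coeff (single 0 i + single 1 j + single 2 l)
      (∑ s ∈ range (n + 1), γ s • ((X 0 : MvPowerSeries (Fin 3) B) ^ s * (X 1) ^ (n - s))) = if l = 0 then γ i else 0 := by
  rw [map_sum]
  have key : ∀ s, coeff (single 0 i + single 1 j + single 2 l) ((X 0 : MvPowerSeries (Fin 3) B) ^ s * (X 1) ^ (n - s)) =
      if s = i ∧ n - s = j ∧ 0 = l then 1 else 0 := by
    intro s
    rw [← mul_one ((X 0 : MvPowerSeries (Fin 3) B) ^ s * X 1 ^ (n - s)), ← pow_zero (X 2 : MvPowerSeries (Fin 3) B),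
      coeff_X_pow_mul_X_pow_mul_X_pow]
  simp_rw [map_smul, key, smul_eq_mul, mul_ite, mul_one, mul_zero]
  by_cases hl : l = 0
  · rw [if_pos hl, sum_eq_single i (fun s _ hs => if_neg fun h' => hs h'.1) (fun h' => absurd (mem_range.mpr (by omega)) h'),
      if_pos ⟨rfl, by omega, hl.symm⟩]
  · rw [if_neg hl]
    exact sum_eq_zero fun s _ => if_neg fun h' => hl h'.2.2.symm

/-- Coefficient of `Y₀^i Y₁^j Y₂^l` (`i+j+l = n`) in `Γ(Y₁,Y₂)`: `γ_j` if `i = 0`, else `0`. [cite: Lazard1955, §III (3.5)–(3.6)] -/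
theorem coeff_homog_subst_12 (γ : ℕ → B) {n i j l : ℕ} (h : i + j + l = n) :
    coeff (single 0 i + single 1 j + single 2 l)
      (∑ s ∈ range (n + 1), γ s • ((X 1 : MvPowerSeries (Fin 3) B) ^ s * (X 2) ^ (n - s))) = if i = 0 then γ j else 0 := by
  rw [map_sum]
  have key : ∀ s, coeff (single 0 i + single 1 j + single 2 l) ((X 1 : MvPowerSeries (Fin 3) B) ^ s * (X 2) ^ (n - s)) =
      if 0 = i ∧ s = j ∧ n - s = l then 1 else 0 := by
    intro s
    rw [← one_mul ((X 1 : MvPowerSeries (Fin 3) B) ^ s * X 2 ^ (n - s)), ← pow_zero (X 0 : MvPowerSeries (Fin 3) B),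
      ← mul_assoc, coeff_X_pow_mul_X_pow_mul_X_pow]
  simp_rw [map_smul, key, smul_eq_mul, mul_ite, mul_one, mul_zero]
  by_cases hi : i = 0
  · rw [if_pos hi, sum_eq_single j (fun s _ hs => if_neg fun h' => hs h'.2.1) (fun h' => absurd (mem_range.mpr (by omega)) h'),
      if_pos ⟨hi.symm, rfl, by omega⟩]
  · rw [if_neg hi]
    exact sum_eq_zero fun s _ => if_neg fun h' => hi h'.1.symm

/-- Coefficient of `Y₀^i Y₁^j Y₂^l` (`i+j+l = n`) in `Γ(Y₀+Y₁,Y₂)`: `C(i+j,i) γ_{i+j}`. [cite: Lazard1955, §III (3.5)–(3.6)] -/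
theorem coeff_homog_subst_add_2 (γ : ℕ → B) {n i j l : ℕ} (h : i + j + l = n) :
    coeff (single 0 i + single 1 j + single 2 l)
      (∑ s ∈ range (n + 1), γ s • ((X 0 + X 1 : MvPowerSeries (Fin 3) B) ^ s * (X 2) ^ (n - s))) =
      ((i + j).choose i : B) * γ (i + j) := by
  rw [map_sum]
  have key : ∀ s, coeff (single 0 i + single 1 j + single 2 l) ((X 0 + X 1 : MvPowerSeries (Fin 3) B) ^ s * (X 2) ^ (n - s)) =
      if s = i + j then ((i + j).choose i : B) else 0 := by
    intro s
    rw [add_pow, Finset.sum_mul, map_sum]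
    have key2 : ∀ t ∈ range (s + 1), coeff (single 0 i + single 1 j + single 2 l)
        ((X 0 : MvPowerSeries (Fin 3) B) ^ t * X 1 ^ (s - t) * (s.choose t : MvPowerSeries (Fin 3) B) * X 2 ^ (n - s)) =
        if t = i ∧ s - t = j ∧ n - s = l then (s.choose t : B) else 0 := by
      intro t _
      rw [mul_assoc, mul_comm (s.choose t : MvPowerSeries (Fin 3) B), ← mul_assoc, ← map_natCast (C (σ := Fin 3) (R := B)),
        mul_comm, coeff_C_mul, coeff_X_pow_mul_X_pow_mul_X_pow, mul_ite, mul_one, mul_zero]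
    rw [sum_congr rfl key2]
    by_cases hs : s = i + j
    · rw [if_pos hs, sum_eq_single i (fun t _ ht => if_neg fun h' => ht h'.1)
        (fun h' => absurd (mem_range.mpr (by omega)) h'), if_pos ⟨rfl, by omega, by omega⟩, hs]
    · rw [if_neg hs]
      exact sum_eq_zero fun t _ => if_neg fun h' => hs (by omega)
  simp_rw [map_smul, key, smul_eq_mul, mul_ite, mul_zero]
  rw [sum_eq_single (i + j) (fun s _ hs => if_neg hs) (fun h' => absurd (mem_range.mpr (by omega)) h'), if_pos rfl, mul_comm]

/-- Coefficient of `Y₀^i Y₁^j Y₂^l` (`i+j+l = n`) in `Γ(Y₀,Y₁+Y₂)`: `C(n-i,j) γ_i`. [cite: Lazard1955, §III (3.5)–(3.6)] -/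
theorem coeff_homog_subst_0_add (γ : ℕ → B) {n i j l : ℕ} (h : i + j + l = n) :
    coeff (single 0 i + single 1 j + single 2 l)
      (∑ s ∈ range (n + 1), γ s • ((X 0 : MvPowerSeries (Fin 3) B) ^ s * (X 1 + X 2) ^ (n - s))) =
      ((n - i).choose j : B) * γ i := by
  rw [map_sum]
  have key : ∀ s, coeff (single 0 i + single 1 j + single 2 l) ((X 0 : MvPowerSeries (Fin 3) B) ^ s * (X 1 + X 2) ^ (n - s)) =
      if s = i then ((n - i).choose j : B) else 0 := by
    intro s
    rw [add_pow, Finset.mul_sum, map_sum]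
    have key2 : ∀ t ∈ range (n - s + 1), coeff (single 0 i + single 1 j + single 2 l)
        ((X 0 : MvPowerSeries (Fin 3) B) ^ s * (X 1 ^ t * X 2 ^ (n - s - t) * ((n - s).choose t : MvPowerSeries (Fin 3) B))) =
        if s = i ∧ t = j ∧ n - s - t = l then ((n - s).choose t : B) else 0 := by
      intro t _
      rw [← map_natCast (C (σ := Fin 3) (R := B)), mul_comm _ (C _), ← mul_assoc, mul_comm _ (C _), mul_assoc, coeff_C_mul,
        ← mul_assoc, coeff_X_pow_mul_X_pow_mul_X_pow, mul_ite, mul_one, mul_zero]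
    rw [sum_congr rfl key2]
    by_cases hs : s = i
    · rw [if_pos hs, sum_eq_single j (fun t _ ht => if_neg fun h' => ht h'.2.1)
        (fun h' => absurd (mem_range.mpr (by omega)) h'), if_pos ⟨hs, rfl, by omega⟩, hs]
    · rw [if_neg hs]
      exact sum_eq_zero fun t _ => if_neg fun h' => hs h'.1
  simp_rw [map_smul, key, smul_eq_mul, mul_ite, mul_zero]
  rw [sum_eq_single i (fun s _ hs => if_neg hs) (fun h' => absurd (mem_range.mpr (by omega)) h'), if_pos rfl, mul_comm]

/-! ## §3 Swapping the variables -/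

/-- `[X₀^i X₁^{n-i}] Γ(X₁,X₀) = γ_{n-i}` (`i ≤ n`). [cite: Lazard1955, §III (3.4)] -/
theorem coeff_homog_swap (γ : ℕ → B) {n i : ℕ} (hi : i ≤ n) :
    coeff (single 0 i + single 1 (n - i)) (∑ s ∈ range (n + 1), γ s • ((X 1) ^ s * (X 0) ^ (n - s)) : MvPowerSeries (Fin 2) B) =
      γ (n - i) := by
  rw [map_sum]
  simp_rw [map_smul, mul_comm ((X 1 : MvPowerSeries (Fin 2) B) ^ _) ((X 0) ^ _), coeff_X_pow_mul_X_pow, smul_eq_mul, mul_ite,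
    mul_one, mul_zero]
  rw [sum_eq_single (n - i) (fun s _ hs => if_neg fun h => hs (by omega)) (fun h => absurd (mem_range.mpr (by omega)) h)]
  rw [if_pos ⟨by omega, rfl⟩]

end Literature.RingTheory.FormalGroups
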